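import Literature.AnabelianGeometry.SemiGraphs.ProSigmaCompletionMaxQuotient
import Literature.AnabelianGeometry.SemiGraphs.ProSigmaClosedSurfaceSlim
import Literature.AnabelianGeometry.SemiGraphs.ProSigmaClosedSurfaceElastic
import Literature.AnabelianGeometry.SemiGraphs.ProSigmaSurfaceTorsionFree
import Literature.AnabelianGeometry.AbsoluteAnabelian.ProfiniteFiniteNormalTorsionFree
import Literature.GroupTheory.CombinatorialGroupTheory.SurfaceGroupFiniteIndexSubgroupHolds
import Literature.GroupTheory.ProfiniteSubquotients
import Mathlib.Data.ZMod.QuotientGroup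
import HarnessLib

/-!
# [AbsTopI] Prop 2.3 (i) at the GFG CONSTRUCTION of Def 2.1 (i): no finite normal subgroups, slim and elastic

S. Mochizuki, *Topics in Absolute Anabelian Geometry I: Generalities* (2012) [AbsTopI] (lit key
`paper:url-11ac98ba15fc`), Def 2.1 (i) p. 17: "`π₁(X_k̄) ↠ Δ_X` an almost pro-`Σ`-maximal quotient … we also
assume that … the kernel of the resulting homomorphism `Δ_X → Gal(Y/X)` is pro-`Σ`.  Thus
`Ker(Δ_X → Gal(Y/X))` may be identified with the maximal pro-`Σ` quotient of `Ker(π₁(X_k̄) → Gal(Y/X))`";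
Prop 2.3 (i) p. 19: "`Δ` is slim and elastic".

THE MODEL (the tree's presentation convention for geometric fundamental groups of hyperbolic curves, as in
`ProSigmaClosedSurfaceElastic.lean` / `AbsTopIProp23iiAlmostProSigmaModel.lean`): `P` profinite, `j : Γ → P` a
pro-`Σ′` completion of a closed surface group `Γ ≅ S_g`, `g ≥ 2` (`Σ ⊆ Σ′`; `Σ′ = 𝔓𝔯𝔦𝔪𝔢𝔰` is print's `π₁(X_k̄)`),
`U ⊴ P` open (`= π₁(Y_k̄)`, `Y → X` finite étale Galois), `π : P ↠ D` continuous with `ker π ≤ U` whose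
restriction `U ↠ π(U)` PRESENTS THE MAXIMAL PRO-`Σ` QUOTIENT of `U` (`PSCDatum.IsMaxProSigmaQuotient`) — so
`D = Δ_X`, `π(U) = Ker(Δ_X → Gal(Y/X)) = U^Σ`.

THEOREMS (proof-only; no definition, no named fact):
* `centralizer_map_eq_bot` — **(T1) `Z_D(π(U)) = 1`**: the deck group `Gal(Y/X) = D/π(U)` acts OUTER-faithfully
  on `U^Σ`.  Proof: for `δ ∈ Z_D(π(U))`, `δ ∉ π(U)` unless `δ = 1` (`π(U)` is slim, a pro-`Σ` surface group);
  `δ` has finite order; `W := π(U)·⟨δ⟩` is open with `δ` central; `U′ := π⁻¹W ⊇ U`; the maximal pro-`Σ`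
  quotient `Q″` of `U′` is a pro-`Σ` completion of the surface group `Γ″ := j⁻¹U′` (genus `g″`), hence slim;
  commutators `[z, U′]` with `π z ∈ ⟨δ⟩` die in `π`, hence in `Q″`, so such `z` map to the centre of `Q″`, i.e.
  to `1`; by maximality (`K_Σ(U′) ≤ ker(U′ → W/⟨δ⟩)`, `W/⟨δ⟩` being pro-`Σ` as an image of `π(U)`) the
  restriction `U ↠ Q″` has kernel exactly `K_Σ(U)`, so `Q″` is ALSO a pro-`Σ` completion of `Γ′ := j⁻¹U`
  (genus `g′`); free pro-`ℓ` ranks give `2g′ = 2g″`, while `g′ − 1 = [U′ : U](g″ − 1)` (F_cov) — so `U′ = U`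
  and `δ ∈ π(U)`, `δ = 1`.
* `forall_isOfFinOrder_eq_one_map` — **(T2)** `π(U)` is torsion-free (pro-`Σ` surface groups are);
* `forall_finite_normal_eq_bot` — **(T3)** `D` has no nontrivial finite normal subgroup
  (`finite_normal_eq_bot_of_torsionFree_of_centralizer_eq_bot`, p436548) — the hypothesis (FN) of
  `ProfiniteSlimAscent.lean` (p433420) is a THEOREM at the Def 2.1 (i) construction;
* `slim_and_elastic` — **(T4)** `D` is slim and elastic (`Σ` containing a prime).

HONEST SCOPE: model-level, at the Def 2.1 (i) construction for PROPER hyperbolic curves (closed surface groups;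
the affine case is analogous, not here), under the Riemann-existence presentation of `π₁(X_k̄)`; orbicurves and
tame/char-`p` aspects outside.  Classical profinite group theory; OUR kernel check; nothing on [IUTchIII] Cor. 3.12.
-/

noncomputable section

open Topology

universe u

namespace Literature.AnabelianGeometry.AbsoluteAnabelian

namespace GFGSurfaceModel

open Literature.AlgebraicGeometry.Frobenioids (IsSlimGroup)
open Literature.AnabelianGeometry.Anabelioids (IsSigmaInteger)
open Literature.AnabelianGeometry.SemiGraphs (IsProSigma)
open Literature.AnabelianGeometry.SemiGraphs.PSCDatum (IsMaxProSigmaQuotient exists_isMaxProSigmaQuotient)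
open Literature.AnabelianGeometry.SemiGraphs.SemiGraphOfAnabelioids
open Literature.AnabelianGeometry.SemiGraphs.SemiGraphOfAnabelioids.IsProSigmaCompletion
open Literature.GroupTheory.CombinatorialGroupTheory
open Literature.GroupTheory.ProfiniteSubquotients
open Literature.Topology.FourManifolds (SurfaceGroup)

variable {Sigma Sigma' : Set ℕ} {Γ : Type*} [Group Γ]
  {P : Type u} [Group P] [TopologicalSpace P] [IsTopologicalGroup P] [CompactSpace P]
  [TotallyDisconnectedSpace P]
  {D : Type u} [Group D] [TopologicalSpace D] [IsTopologicalGroup D] [CompactSpace D] [T2Space D]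
  [TotallyDisconnectedSpace D]
  {j : Γ →* P} {π : P →* D} {U : Subgroup P}

omit [Group Γ] in
/-- F_cov along an isomorphism `Γ ≅ S_g`: a finite-index subgroup `H ≤ Γ` is `≅ S_h` with
`h = [Γ : H](g − 1) + 1` (the tree's theorem `surfaceGroupFiniteIndexSubgroup_holds`).
[cite: ZieschangVogtColdewey1980, Prop 4.14.23 p.154] -/
theorem exists_mulEquiv_surfaceGroup_of_finiteIndex [Group Γ] {g : ℕ} (hg : 2 ≤ g) (e : Γ ≃* SurfaceGroup g)
    (H : Subgroup Γ) [H.FiniteIndex] :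
    ∃ h : ℕ, h = H.index * (g - 1) + 1 ∧ Nonempty (H ≃* SurfaceGroup h) := by
  let K : Subgroup (SurfaceGroup g) := H.map (e : Γ →* SurfaceGroup g)
  have hK : K.index = H.index := Subgroup.index_map_equiv H e
  haveI : K.FiniteIndex := ⟨by rw [hK]; exact Subgroup.FiniteIndex.index_ne_zero⟩
  obtain ⟨h, hh, ⟨eK⟩⟩ := surfaceGroupFiniteIndexSubgroup_holds g hg K inferInstance
  exact ⟨h, by rw [hh, hK], ⟨(H.equivMapOfInjective (e : Γ →* SurfaceGroup g) e.injective).trans eK⟩⟩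

omit [TotallyDisconnectedSpace P] [IsTopologicalGroup D] [CompactSpace D] [T2Space D]
  [TotallyDisconnectedSpace D] in
/-- `π(U)` is closed in `D` (image of a compact set). [cite: MochizukiAbsTopI2012, Def 2.1 (i) p.17] -/
theorem isClosed_map [T2Space D] (hUo : IsOpen (U : Set P)) (hπc : Continuous π) :
    IsClosed ((U.map π : Subgroup D) : Set D) := by
  have : ((U.map π : Subgroup D) : Set D) = π '' (U : Set P) := Subgroup.coe_map π U
  rw [this]
  exact ((U.isClosed_of_isOpen hUo).isCompact.image hπc).isClosed

omit [TotallyDisconnectedSpace P] [CompactSpace D] [TotallyDisconnectedSpace D] in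
/-- `π(U)` is open in `D` (closed of finite index `[D : π(U)] = [P : U]`, `ker π ≤ U`).
[cite: MochizukiAbsTopI2012, Def 2.1 (i) p.17] -/
theorem isOpen_map (hUo : IsOpen (U : Set P)) (hπc : Continuous π) (hπs : Function.Surjective π)
    (hker : π.ker ≤ U) : IsOpen ((U.map π : Subgroup D) : Set D) := by
  haveI : Finite (P ⧸ U) := Subgroup.quotient_finite_of_isOpen U hUo
  haveI : U.FiniteIndex := Subgroup.finiteIndex_of_finite_quotient
  haveI : (U.map π).FiniteIndex :=
    ⟨by rw [Subgroup.index_map_eq _ hπs hker]; exact Subgroup.FiniteIndex.index_ne_zero⟩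
  exact Subgroup.isOpen_of_isClosed_of_finiteIndex _ (isClosed_map hUo hπc)

omit [TotallyDisconnectedSpace D] in
/-- **`Γ′ := j⁻¹U → π(U)` is a pro-`Σ` completion** ("`Ker(Δ_X → Gal(Y/X))` is the maximal pro-`Σ` quotient of
`π₁(Y_k̄)`", the latter being the pro-`Σ′` completion of the discrete `π₁(Y) = j⁻¹U`).
[cite: MochizukiAbsTopI2012, Def 2.1 (i) p.17] -/
theorem isProSigmaCompletion_map (hSS : Sigma ⊆ Sigma') (hj : IsProSigmaCompletion Sigma' j)
    (hUo : IsOpen (U : Set P)) (hπc : Continuous π) (hmax : IsMaxProSigmaQuotient Sigma (π.subgroupMap U)) :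
    IsProSigmaCompletion Sigma ((π.subgroupMap U).comp (j.subgroupComap U)) := by
  haveI : CompactSpace U := compactSpace_of_isOpen hUo
  haveI : CompactSpace (U.map π) := compactSpace_of_isClosed (isClosed_map hUo hπc)
  exact comp_isMaxProSigmaQuotient hSS (hj.restrict U hUo) hmax

/-! ### (T1) The deck group acts outer-faithfully: `Z_D(π(U)) = 1` -/

/-- **(T1) `Z_D(U^Σ) = 1` at the GFG construction of [AbsTopI] Def 2.1 (i)** (closed surface group `Γ ≅ S_g`,
`g ≥ 2`; `Σ ⊆ Σ′` with `Σ` containing a prime): the centraliser in `D = Δ_X` of the open normal subgroup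
`π(U) = Ker(Δ_X → Gal(Y/X))` is trivial — i.e. `Gal(Y/X)` acts outer-faithfully on `U^Σ`.  See the module
docstring for the proof (slimness + maximality of `K_Σ` + free pro-`ℓ` ranks + F_cov).
[cite: MochizukiAbsTopI2012, Prop 2.3 (i) p.19] -/
theorem centralizer_map_eq_bot (hSS : Sigma ⊆ Sigma') (hS : ∃ ℓ ∈ Sigma, ℓ.Prime) {g : ℕ} (hg : 2 ≤ g)
    (e : Γ ≃* SurfaceGroup g) (hj : IsProSigmaCompletion Sigma' j) [hUn : U.Normal] (hUo : IsOpen (U : Set P))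
    (hπc : Continuous π) (hπs : Function.Surjective π) (hker : π.ker ≤ U)
    (hmax : IsMaxProSigmaQuotient Sigma (π.subgroupMap U)) :
    Subgroup.centralizer ((U.map π : Subgroup D) : Set D) = ⊥ := by
  classical
  have hF := surfaceGroupFiniteIndexSubgroup_holds
  -- the open normal subgroup `Ū = π(U)` and its presentation as a pro-`Σ` surface group
  set Ubar : Subgroup D := U.map π with hUbar
  haveI hUbarn : Ubar.Normal := hUn.map π hπs
  have hUbarc : IsClosed (Ubar : Set D) := isClosed_map hUo hπc
  have hUbaro : IsOpen (Ubar : Set D) := isOpen_map hUo hπc hπs hker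
  haveI : CompactSpace U := compactSpace_of_isOpen hUo
  haveI : CompactSpace Ubar := compactSpace_of_isClosed hUbarc
  haveI : Finite (P ⧸ U) := Subgroup.quotient_finite_of_isOpen U hUo
  haveI : U.FiniteIndex := Subgroup.finiteIndex_of_finite_quotient
  haveI : (U.comap j).FiniteIndex := finiteIndex_comap hj U hUo
  have hidxU : (U.comap j).index = U.index := index_comap_of_isOpen hj U hUo
  obtain ⟨g', hg'eq, ⟨eU⟩⟩ := exists_mulEquiv_surfaceGroup_of_finiteIndex hg e (U.comap j)
  have hg'2 : 2 ≤ g' := two_le_genus_of_index hg Subgroup.FiniteIndex.index_ne_zero hg'eq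
  have hιU := isProSigmaCompletion_map hSS hj hUo hπc hmax
  have hslimU : IsSlimGroup Ubar := isSlimGroup_of_surfaceGroup hF hg'2 eU hιU
  -- central elements of the slim group `Ū` are trivial
  have hcentral : ∀ d ∈ Ubar, (∀ h ∈ Ubar, h * d = d * h) → d = 1 := by
    intro d hd hcomm
    have hmem : (⟨d, hd⟩ : Ubar) ∈ Subgroup.centralizer ((⊤ : Subgroup Ubar) : Set Ubar) := by
      rw [Subgroup.mem_centralizer_iff]
      intro h _
      exact Subtype.ext (hcomm h h.2)
    rw [centralizer_top_eq_bot_of_isSlimGroup hslimU, Subgroup.mem_bot] at hmem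
    exact congrArg Subtype.val hmem
  rw [eq_bot_iff]
  intro δ hδ
  rw [Subgroup.mem_bot]
  rw [Subgroup.mem_centralizer_iff] at hδ
  by_contra hδ1
  have hδU : δ ∉ Ubar := fun h => hδ1 (hcentral δ h hδ)
  -- `δ` commutes with `Ū` and hence its powers do; `δ` has finite order
  have hpowU : ∀ k : ℤ, ∀ h ∈ Ubar, h * δ ^ k = δ ^ k * h := fun k h hh =>
    ((Commute.symm (hδ h hh) : Commute δ h).symm.zpow_right k).eq
  have hδn : δ ^ Ubar.index = 1 := by
    refine hcentral _ (Ubar.pow_index_mem δ) fun h hh => ?_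
    have := hpowU (Ubar.index : ℤ) h hh
    simpa only [zpow_natCast] using this
  haveI : Ubar.FiniteIndex :=
    ⟨by rw [hUbar, Subgroup.index_map_eq _ hπs hker]; exact Subgroup.FiniteIndex.index_ne_zero⟩
  have hδfin : IsOfFinOrder δ :=
    isOfFinOrder_iff_pow_eq_one.mpr ⟨Ubar.index, Nat.pos_of_ne_zero Subgroup.FiniteIndex.index_ne_zero, hδn⟩
  -- the finite cyclic group `C = ⟨δ⟩`, central in the open subgroup `W = Ū·C`, meeting `Ū` trivially
  set C : Subgroup D := Subgroup.zpowers δ with hC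
  have hCc : IsClosed (C : Set D) := hδfin.finite_zpowers.isClosed
  have hCU : ∀ c ∈ C, c ∈ Ubar → c = 1 := by
    intro c hc hcU
    obtain ⟨k, rfl⟩ := Subgroup.mem_zpowers_iff.mp hc
    exact hcentral _ hcU (hpowU k)
  set W : Subgroup D := Ubar ⊔ C with hW
  have hWo : IsOpen (W : Set D) := Subgroup.isOpen_mono le_sup_left hUbaro
  have hδW : δ ∈ W := Subgroup.mem_sup_right (Subgroup.mem_zpowers δ)
  have hWdec : ∀ w ∈ W, ∃ a ∈ Ubar, ∃ c ∈ C, a * c = w := fun w hw =>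
    Subgroup.mem_sup_of_normal_left.mp hw
  have hWcomm : ∀ w ∈ W, ∀ c ∈ C, w * c = c * w := by
    intro w hw c hc
    obtain ⟨a, ha, c', hc', rfl⟩ := hWdec w hw
    obtain ⟨k, rfl⟩ := Subgroup.mem_zpowers_iff.mp hc
    obtain ⟨k', rfl⟩ := Subgroup.mem_zpowers_iff.mp hc'
    rw [mul_assoc, ← zpow_add, add_comm, zpow_add, ← mul_assoc, hpowU k a ha, mul_assoc]
  -- the open subgroup `U′ = π⁻¹ W ⊇ U` of `P` and its discrete group `Γ″ = j⁻¹ U′`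
  set U' : Subgroup P := W.comap π with hU'
  have hU'o : IsOpen (U' : Set P) := hWo.preimage hπc
  have hUU' : U ≤ U' := fun u hu => Subgroup.mem_comap.mpr (Subgroup.mem_sup_left (Subgroup.mem_map_of_mem π hu))
  haveI : CompactSpace U' := compactSpace_of_isOpen hU'o
  haveI : (U'.comap j).FiniteIndex := finiteIndex_comap hj U' hU'o
  have hidxU' : (U'.comap j).index = U'.index := index_comap_of_isOpen hj U' hU'o
  obtain ⟨g'', hg''eq, ⟨eU'⟩⟩ := exists_mulEquiv_surfaceGroup_of_finiteIndex hg e (U'.comap j)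
  have hg''2 : 2 ≤ g'' := two_le_genus_of_index hg Subgroup.FiniteIndex.index_ne_zero hg''eq
  -- the maximal pro-`Σ` quotient `f″ : U′ ↠ Q″`, a pro-`Σ` completion of `Γ″`, hence slim
  obtain ⟨K'', hK''n, hK''c, hf''⟩ := exists_isMaxProSigmaQuotient Sigma (P := U')
  haveI := hK''n
  haveI : IsClosed ((K'' : Subgroup U') : Set U') := hK''c
  haveI : TotallyDisconnectedSpace (U' ⧸ K'') := totallyDisconnectedSpace_quotient K'' hK''c
  set f'' : U' →* U' ⧸ K'' := QuotientGroup.mk' K'' with hf''def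
  have hι'' : IsProSigmaCompletion Sigma (f''.comp (j.subgroupComap U')) :=
    comp_isMaxProSigmaQuotient hSS (hj.restrict U' hU'o) hf''
  have hslimQ : IsSlimGroup (U' ⧸ K'') := isSlimGroup_of_surfaceGroup hF hg''2 eU' hι''
  have hZQ := centralizer_top_eq_bot_of_isSlimGroup hslimQ
  -- `ker π`, seen in `U`, is the kernel of the presentation `U ↠ Ū`; it dies in `Q″`
  have hkerU : ∀ {z : P} (hz : π z = 1), ∃ hzU : z ∈ U, (π.subgroupMap U) ⟨z, hzU⟩ = 1 := by
    intro z hz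
    have hzU : z ∈ U := hker (by rw [MonoidHom.mem_ker]; exact hz)
    exact ⟨hzU, Subtype.ext (by simp [hz])⟩
  have hkerQ : ∀ {z : P} (hz : π z = 1), ∃ hzU' : z ∈ U', f'' ⟨z, hzU'⟩ = 1 := by
    intro z hz
    obtain ⟨hzU, h1⟩ := hkerU hz
    exact ⟨hUU' hzU, map_eq_one_of_isMaxProSigmaQuotient_of_le hUU' hmax hf'' hzU h1⟩
  -- CLAIM B: an element of `U′` whose image lies in `C` (so is central in `W`) dies in `Q″`
  have hB : ∀ (z : P) (hz : z ∈ U'), π z ∈ C → f'' ⟨z, hz⟩ = 1 := by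
    intro z hz hzC
    have hcen : f'' ⟨z, hz⟩ ∈ Subgroup.centralizer ((⊤ : Subgroup (U' ⧸ K'')) : Set (U' ⧸ K'')) := by
      rw [Subgroup.mem_centralizer_iff]
      intro q _
      obtain ⟨⟨y, hy⟩, rfl⟩ := QuotientGroup.mk'_surjective K'' q
      -- the commutator `z y z⁻¹ y⁻¹` dies under `π`, hence under `f″`
      have hπ1 : π (z * y * z⁻¹ * y⁻¹) = 1 := by
        have hc := hWcomm (π y) (Subgroup.mem_comap.mp hy) (π z) hzC
        simp only [map_mul, map_inv]
        rw [← hc]; group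
      obtain ⟨hcU', hc1⟩ := hkerQ hπ1
      have hprod : (⟨z * y * z⁻¹ * y⁻¹, hcU'⟩ : U') = ⟨z, hz⟩ * ⟨y, hy⟩ * ⟨z, hz⟩⁻¹ * ⟨y, hy⟩⁻¹ := rfl
      rw [hprod, map_mul, map_mul, map_mul, map_inv, map_inv] at hc1
      have h1 : f'' ⟨z, hz⟩ * f'' ⟨y, hy⟩ * (f'' ⟨z, hz⟩)⁻¹ = f'' ⟨y, hy⟩ := mul_inv_eq_one.mp hc1
      have h2 : f'' ⟨z, hz⟩ * f'' ⟨y, hy⟩ = f'' ⟨y, hy⟩ * f'' ⟨z, hz⟩ := mul_inv_eq_iff_eq_mul.mp h1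
      exact h2.symm
    rw [hZQ, Subgroup.mem_bot] at hcen
    exact hcen
  -- the quotient `R = W/C`, a profinite pro-`Σ` group (an image of `Ū`)
  have hCW : C ≤ W := le_sup_right
  haveI hCWn : (C.subgroupOf W).Normal := by
    refine ⟨fun c hc w => ?_⟩
    rw [Subgroup.mem_subgroupOf] at hc ⊢
    have : (w : D) * c * (w : D)⁻¹ = c := by
      rw [hWcomm w w.2 c hc, mul_inv_cancel_right]
    simpa [this] using hc
  haveI : CompactSpace W := compactSpace_of_isOpen hWo
  have hCWc : IsClosed ((C.subgroupOf W : Subgroup W) : Set W) := by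
    rw [Subgroup.coe_subgroupOf]
    exact hCc.preimage continuous_subtype_val
  haveI : IsClosed ((C.subgroupOf W : Subgroup W) : Set W) := hCWc
  haveI : TotallyDisconnectedSpace (W ⧸ C.subgroupOf W) := totallyDisconnectedSpace_quotient _ hCWc
  set ρ : W →* W ⧸ C.subgroupOf W := QuotientGroup.mk' (C.subgroupOf W) with hρ
  have hρC : ∀ (w : D) (hw : w ∈ W), w ∈ C → ρ ⟨w, hw⟩ = 1 := fun w hw hwC => by
    rw [hρ, QuotientGroup.mk'_apply, QuotientGroup.eq_one_iff, Subgroup.mem_subgroupOf]; exact hwC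
  have hR : IsProSigma Sigma (W ⧸ C.subgroupOf W) := by
    let θ₀ : Ubar →* W ⧸ C.subgroupOf W := ρ.comp (Subgroup.inclusion (le_sup_left : Ubar ≤ W))
    have hθc : Continuous θ₀ := by
      refine QuotientGroup.continuous_mk.comp ?_
      rw [continuous_induced_rng]
      exact continuous_subtype_val
    have hθs : Function.Surjective θ₀ := by
      intro r
      obtain ⟨⟨w, hw⟩, rfl⟩ := QuotientGroup.mk'_surjective (C.subgroupOf W) r
      obtain ⟨a, ha, c, hc, rfl⟩ := hWdec w hw
      refine ⟨⟨a, ha⟩, ?_⟩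
      have hprod : (⟨a * c, hw⟩ : W) = ⟨a, le_sup_left (a := Ubar) ha⟩ * ⟨c, hCW hc⟩ := rfl
      change ρ ⟨a, _⟩ = ρ ⟨a * c, hw⟩
      rw [hprod, map_mul, hρC c (hCW hc) hc, mul_one]
    exact hmax.proSigma.of_surjective θ₀ hθc hθs
  -- CLAIM C: `K_Σ(U′) = ker f″` maps into `C` under `π` (maximality against `U′ → W → W/C`)
  let φ : U' →* W ⧸ C.subgroupOf W := ρ.comp (π.subgroupComap W)
  have hφc : Continuous φ := by
    refine QuotientGroup.continuous_mk.comp ?_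
    rw [continuous_induced_rng]
    exact hπc.comp continuous_subtype_val
  have hC' : ∀ (k : P) (hk : k ∈ U'), f'' ⟨k, hk⟩ = 1 → π k ∈ C := by
    intro k hk h1
    have hmem : (⟨k, hk⟩ : U') ∈ φ.ker :=
      ker_le_ker_of_isMaxProSigmaQuotient hf'' hR φ hφc (by rw [MonoidHom.mem_ker]; exact h1)
    rw [MonoidHom.mem_ker] at hmem
    change ρ ⟨π k, _⟩ = 1 at hmem
    rw [hρ, QuotientGroup.mk'_apply, QuotientGroup.eq_one_iff, Subgroup.mem_subgroupOf] at hmem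
    exact hmem
  -- CLAIM D: the restriction `ψ : U ↠ Q″` ALSO presents the maximal pro-`Σ` quotient of `U`
  let ψ : U →* U' ⧸ K'' := f''.comp (Subgroup.inclusion hUU')
  have hψ : IsMaxProSigmaQuotient Sigma ψ := by
    refine ⟨?_, ?_, hf''.proSigma, ?_⟩
    · refine hf''.continuous.comp ?_
      rw [continuous_induced_rng]
      exact continuous_subtype_val
    · intro q
      obtain ⟨⟨y, hy⟩, rfl⟩ := QuotientGroup.mk'_surjective K'' q
      obtain ⟨a, ha, c, hc, hac⟩ := hWdec (π y) (Subgroup.mem_comap.mp hy)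
      obtain ⟨u, hu, rfl⟩ := Subgroup.mem_map.mp ha
      have hz : u⁻¹ * y ∈ U' := U'.mul_mem (U'.inv_mem (hUU' hu)) hy
      have hzC : π (u⁻¹ * y) ∈ C := by
        rw [map_mul, map_inv, ← hac, inv_mul_cancel_left]; exact hc
      have h1 := hB _ hz hzC
      refine ⟨⟨u, hu⟩, ?_⟩
      have hprod : (⟨y, hy⟩ : U') = ⟨u, hUU' hu⟩ * ⟨u⁻¹ * y, hz⟩ := Subtype.ext (by simp)
      change f'' ⟨u, hUU' hu⟩ = f'' ⟨y, hy⟩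
      rw [hprod, map_mul, h1, mul_one]
    · intro N hNn hNo hNS
      refine le_trans (fun x hx => ?_) (hmax.ker_le N hNn hNo hNS)
      obtain ⟨k, hk⟩ := x
      rw [MonoidHom.mem_ker] at hx ⊢
      have hπk : π k ∈ C := hC' k (hUU' hk) hx
      have hπk1 : π k = 1 := hCU _ hπk (Subgroup.mem_map_of_mem π hk)
      exact Subtype.ext (by simp [hπk1])
  -- hence `Q″` is a pro-`Σ` completion of BOTH `Γ′` (genus `g′`) and `Γ″` (genus `g″`): compare ranks
  have hιψ : IsProSigmaCompletion Sigma (ψ.comp (j.subgroupComap U)) :=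
    comp_isMaxProSigmaQuotient hSS (hj.restrict U hUo) hψ
  obtain ⟨ℓ, hℓS, hℓ⟩ := hS
  haveI : Fact ℓ.Prime := ⟨hℓ⟩
  have r1 := freeProlRank_eq_of_surfaceGroup hιψ eU hℓS
  have r2 := freeProlRank_eq_of_surfaceGroup hι'' eU' hℓS
  have hgg : g' = g'' := by
    have : ((2 * g' : ℕ) : ℕ∞) = ((2 * g'' : ℕ) : ℕ∞) := r1.symm.trans r2
    have := ENat.coe_inj.mp this
    omega
  -- so `[P : U] = [P : U′]`, `U′ = U`, and `δ ∈ π(U′) = π(U)`: contradiction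
  have hidx : U.index = U'.index := by
    have h1 : U.index * (g - 1) + 1 = U'.index * (g - 1) + 1 := by
      rw [← hidxU, ← hidxU', ← hg'eq, ← hg''eq, hgg]
    have hg1 : g - 1 ≠ 0 := by omega
    exact Nat.eq_of_mul_eq_mul_right (Nat.pos_of_ne_zero hg1) (by omega)
  have hle : U' ≤ U := by
    have hmul := Subgroup.relIndex_mul_index hUU'
    rw [hidx] at hmul
    haveI : U'.FiniteIndex := Subgroup.finiteIndex_of_le hUU'
    have hrel : U.relIndex U' = 1 := by
      have hne : U'.index ≠ 0 := Subgroup.FiniteIndex.index_ne_zero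
      exact (mul_eq_right₀ hne).mp hmul
    exact Subgroup.relIndex_eq_one.mp hrel
  obtain ⟨x, hx⟩ := hπs δ
  have hxU' : x ∈ U' := Subgroup.mem_comap.mpr (by rw [hx]; exact hδW)
  exact hδU (by rw [← hx]; exact Subgroup.mem_map_of_mem π (hle hxU'))

/-- **(T2)** `π(U) = U^Σ` is torsion-free (a pro-`Σ` completion of the closed surface group `j⁻¹U ≅ S_{g′}`,
`g′ ≥ 2`; [AbsTopI] Lem 4.5 (i)). [cite: MochizukiAbsTopI2012, Lemma 4.5 (i) p.54] -/
theorem forall_isOfFinOrder_eq_one_map (hSS : Sigma ⊆ Sigma') {g : ℕ} (hg : 2 ≤ g) (e : Γ ≃* SurfaceGroup g)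
    (hj : IsProSigmaCompletion Sigma' j) (hUo : IsOpen (U : Set P)) (hπc : Continuous π)
    (hmax : IsMaxProSigmaQuotient Sigma (π.subgroupMap U)) :
    ∀ d ∈ U.map π, IsOfFinOrder d → d = 1 := by
  haveI : CompactSpace (U.map π) := compactSpace_of_isClosed (isClosed_map hUo hπc)
  haveI : (U.comap j).FiniteIndex := finiteIndex_comap hj U hUo
  obtain ⟨g', hg'eq, ⟨eU⟩⟩ := exists_mulEquiv_surfaceGroup_of_finiteIndex hg e (U.comap j)
  have hg'2 : 2 ≤ g' := two_le_genus_of_index hg Subgroup.FiniteIndex.index_ne_zero hg'eq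
  have hιU := isProSigmaCompletion_map hSS hj hUo hπc hmax
  intro d hd hfin
  have hfin' : IsOfFinOrder (⟨d, hd⟩ : U.map π) :=
    (Subgroup.subtype_injective _).isOfFinOrder_iff.mp (by simpa using hfin)
  have := (isOfFinOrder_iff_surfaceGroup hιU hg'2 eU).mp hfin'
  simpa using congrArg Subtype.val this

/-- **(T3) `Δ_X` has no nontrivial finite normal subgroup** at the GFG construction of Def 2.1 (i) — the
hypothesis (FN) of the slimness ascent (`ProfiniteSlimAscent.lean`) DISCHARGED here, via
`finite_normal_eq_bot_of_torsionFree_of_centralizer_eq_bot` with the torsion-free normal subgroup `π(U)` of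
trivial centraliser. [cite: MochizukiAbsTopI2012, Prop 2.3 (i) p.19] -/
theorem forall_finite_normal_eq_bot (hSS : Sigma ⊆ Sigma') (hS : ∃ ℓ ∈ Sigma, ℓ.Prime) {g : ℕ} (hg : 2 ≤ g)
    (e : Γ ≃* SurfaceGroup g) (hj : IsProSigmaCompletion Sigma' j) [U.Normal] (hUo : IsOpen (U : Set P))
    (hπc : Continuous π) (hπs : Function.Surjective π) (hker : π.ker ≤ U)
    (hmax : IsMaxProSigmaQuotient Sigma (π.subgroupMap U)) :
    ∀ N : Subgroup D, N.Normal → (N : Set D).Finite → N = ⊥ :=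
  haveI : (U.map π).Normal := Subgroup.Normal.map inferInstance π hπs
  finite_normal_eq_bot_of_torsionFree_of_centralizer_eq_bot (U.map π)
    (forall_isOfFinOrder_eq_one_map hSS hg e hj hUo hπc hmax)
    (centralizer_map_eq_bot hSS hS hg e hj hUo hπc hπs hker hmax)

/-- **(T4) [AbsTopI] Prop 2.3 (i) at the GFG construction: `Δ_X` is slim and elastic**, UNCONDITIONALLY at this
model — the ascent `slim_and_elastic_of_isOpen_normal_torsionFree` (p436548 over p433420/p432240) fed with the open
normal pro-`Σ` surface group `π(U)` (slim: `isSlimGroup_of_surfaceGroup`; elastic: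
`isElastic_of_isProSigmaCompletion_surfaceGroup`; torsion-free (T2); trivial centraliser (T1)).
[cite: MochizukiAbsTopI2012, Prop 2.3 (i) p.19] -/
theorem slim_and_elastic (hSS : Sigma ⊆ Sigma') (hS : ∃ ℓ ∈ Sigma, ℓ.Prime) {g : ℕ} (hg : 2 ≤ g)
    (e : Γ ≃* SurfaceGroup g) (hj : IsProSigmaCompletion Sigma' j) [U.Normal] (hUo : IsOpen (U : Set P))
    (hπc : Continuous π) (hπs : Function.Surjective π) (hker : π.ker ≤ U)
    (hmax : IsMaxProSigmaQuotient Sigma (π.subgroupMap U)) : IsSlimGroup D ∧ IsElastic D := by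
  haveI : (U.map π).Normal := Subgroup.Normal.map inferInstance π hπs
  haveI : CompactSpace (U.map π) := compactSpace_of_isClosed (isClosed_map hUo hπc)
  haveI : (U.comap j).FiniteIndex := finiteIndex_comap hj U hUo
  obtain ⟨g', hg'eq, ⟨eU⟩⟩ := exists_mulEquiv_surfaceGroup_of_finiteIndex hg e (U.comap j)
  have hg'2 : 2 ≤ g' := two_le_genus_of_index hg Subgroup.FiniteIndex.index_ne_zero hg'eq
  have hιU := isProSigmaCompletion_map hSS hj hUo hπc hmax
  obtain ⟨ℓ, hℓS, hℓ⟩ := hS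
  exact slim_and_elastic_of_isOpen_normal_torsionFree (U.map π) (isOpen_map hUo hπc hπs hker)
    (isSlimGroup_of_surfaceGroup surfaceGroupFiniteIndexSubgroup_holds hg'2 eU hιU)
    (isElastic_of_isProSigmaCompletion_surfaceGroup hιU hg'2 eU hℓ hℓS)
    (forall_isOfFinOrder_eq_one_map hSS hg e hj hUo hπc hmax)
    (centralizer_map_eq_bot hSS ⟨ℓ, hℓS, hℓ⟩ hg e hj hUo hπc hπs hker hmax)

end GFGSurfaceModel

end Literature.AnabelianGeometry.AbsoluteAnabelian

end
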